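import Literature.NumberTheory.Automorphic.GL2NewvectorGaussSumOperator
import Literature.NumberTheory.Automorphic.GL2FiniteAdelicWhittaker
import Literature.NumberTheory.Automorphic.CuspFormFourierExpansionGL2
import Literature.NumberTheory.Automorphic.CuspFormFourierExpansionGL2Inputs
import Literature.NumberTheory.Automorphic.WhittakerCoeffCuspidal
import Literature.NumberTheory.Automorphic.AutomorphicFormsGLContinuous
import Literature.NumberTheory.Automorphic.AutomorphicFormsSpan
import Mathlib.Analysis.Fourier.ZMod
import Mathlib.NumberTheory.DirichletCharacter.GaussSum
import HarnessLib

/-!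
# Existence of the new vector for automorphic representations of `GL₂(𝔸_ℚ)` with cuspidal forms
# (Casselman 1973, Thm. 1, existence half) — an elementary global proof

Topic `NumberTheory/Automorphic`; namespace `Literature.NumberTheory.Automorphic`. Theorems only
(no named fact). **Theorem** (`AutomorphicRepData.exists_mem_gammaOneFiniteInvariants_of_fixed`,
`CuspidalAutomorphicRepData.exists_gammaOneFiniteLevel_fixed`): let `π` be an automorphic
representation of `GL₂(𝔸_ℚ)` (Borel–Jacquet datum) whose forms are cusp forms. Then `π` contains a
non-zero form right invariant under `{1} × K₁(L)` for some `L ≥ 1`. This is the existence half of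
Casselman's theorem on the new vector (Casselman 1973, Thm. 1: `π_p^{K₁(p^c)} ≠ 0` for `c = c(π_p)`,
proved there from the Kirillov model), in the global form in which Gelbart 1975, Thm. 5.19 and
Gelbart 1997, Prop. 2.5 (converse) consume it; it is the hypothesis `hfix` of the tree's
`StrongArtinGL2WeightOneAssembly`.

The proof given here is global and elementary (it is not Casselman's): start from a non-zero
`K(M)`-fixed `ψ ∈ π` (`exists_principalCongruenceLevel_fixed`) and the `χ ∘ [det]`-eigenvector `v` of
`K₁(M²)` it yields (`GL2NewvectorGaussSumOperator`, after the tree's `GL2NewvectorUpToTwist`); the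
Gauss-sum torus averages `B_d v` (`gaussTorusAverage`, `d = M₀ m`, `M₀` the conductor of `χ`) are
`K₁((dM)²)`-invariant forms of `π`, and **one of them is non-zero**:

* `DirichletCharacter.IsPrimitive.gaussSum_stdAddChar_ne_zero` — `G(χ₀) ≠ 0` for a primitive `χ₀`
  (Mathlib's Fourier inversion on `ℤ/N`);
* `whittakerCoeff_torus_summand`, `whittakerCoeff_torus_natCast_eq_zero` — the `ψ_ℚ`-Whittaker
  coefficients of the summands of `B_d v` at `(h, d(m))`, `d = M₀ m`, add up to
  `(∑_{a ∈ (ℤ/dM)ˣ} e^{2πi a/M₀} χ(a)) · W_v((h, d(m)))`, and the character sum is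
  `#ker((ℤ/dM)ˣ → (ℤ/M₀)ˣ) · G(χ₀) ≠ 0` (`gaussTorus_charSum_ne_zero`); so if `B_{M₀ m} v = 0` then
  `W_v((h, d(m))) = 0` for all `h ∈ GL₂(ℝ)`;
* then `W_v((h, d(y))) = 0` for every finite idele `y` (`y = m · (unit)` if integral, support of the
  Whittaker function of an `n(ẑ)`-fixed vector otherwise: `GL2FiniteAdelicWhittaker`), so by the
  Fourier–Whittaker expansion of cusp forms on `GL₂` (`Shalika1974_fourierExpansion_cuspForm_two`,
  proved in the tree) `v((h, 1)) = 0` for all `h`, and by strong approximation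
  (`GL₂(𝔸) = GL₂(ℚ)(GL₂(ℝ) × K₁(M²))`) and the eigenvector property `v = 0` — a contradiction.

Corollary (`CuspidalAutomorphicRepData.exists_gammaOneFiniteLevel_fixed`): the hypothesis `hfix` of
`StrongArtinGL2WeightOneAssembly.exists_isNewform1_of_isPiOfArtinRep_of_pair_of_fixed`, for every
cuspidal `π`.

## References

* W. Casselman, *On some results of Atkin and Lehner*, Math. Ann. 201 (1973), Thm. 1 [Casselman1973].
* S. Gelbart, *Automorphic forms on adele groups* (1975), Thm. 5.19 and §5.B [Gelbart1975].
* J. W. Cogdell, *Analytic theory of L-functions for GL_n* (2004), §1.1–1.2 (Fourier expansion,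
  global genericity of cusp forms) [CogdellAnalyticTheory2004].
-/

noncomputable section

open MeasureTheory NumberField IsDedekindDomain Matrix
open scoped MatrixGroups Classical ComplexConjugate

namespace Literature.NumberTheory.Automorphic

open IsDedekindDomain.HeightOneSpectrum Rat.HeightOneSpectrum GaloisRepresentations

/-! ### Gauss sums of primitive characters do not vanish -/

section Gauss

open ZMod in
/-- **`G(χ₀, e^{2πi·/N}) ≠ 0` for a primitive Dirichlet character `χ₀` mod `N`**: the discrete
Fourier transform of `χ₀` is `G(χ₀) χ₀⁻¹(-·)` (Mathlib), and Fourier inversion `𝓕𝓕χ₀ = N χ₀(-·)`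
would give `N χ₀(1) = 0` if `G(χ₀) = 0`. (The same six-line fact is
`EllipticCurves.gaussSum_stdAddChar_ne_zero` of `PAdicLFunctionProofs`, whose import cone —
`p`-adic `L`-functions, Hensel — is foreign to this file; restated here rather than imported.)
[folklore] -/
theorem DirichletCharacter.IsPrimitive.gaussSum_stdAddChar_ne_zero {N : ℕ} [NeZero N]
    {χ : DirichletCharacter ℂ N} (hχ : χ.IsPrimitive) : gaussSum χ (stdAddChar (N := N)) ≠ 0 := by
  intro h0
  have h1 : dft (χ : ZMod N → ℂ) = 0 := by
    funext k
    rw [hχ.fourierTransform_eq_inv_mul_gaussSum, h0, mul_zero]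
    rfl
  have h2 := dft_dft (χ : ZMod N → ℂ)
  rw [h1, map_zero] at h2
  have h3 := congrFun h2 (-1)
  rw [Pi.zero_apply, neg_neg, map_one, smul_eq_mul, mul_one] at h3
  exact (Nat.cast_ne_zero.2 (NeZero.ne N) : (N : ℂ) ≠ 0) h3.symm

/-- **Summing over a surjection of finite groups**: `∑_{a ∈ G} f(π a) = #ker π · ∑_{b ∈ H} f(b)`
(all fibres of `π` have `#ker π` elements). [folklore] -/
theorem sum_comp_eq_card_fiber_smul {G H : Type*} [Group G] [Fintype G] [Group H] [Fintype H] [DecidableEq H]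
    (π : G →* H) (hπ : Function.Surjective π) (f : H → ℂ) :
    ∑ a : G, f (π a) = ((Finset.univ.filter fun a : G => π a = 1).card : ℂ) * ∑ b : H, f b := by
  rw [← Finset.sum_fiberwise' Finset.univ π f, Finset.mul_sum]
  refine Finset.sum_congr rfl fun b _ => ?_
  rw [Finset.sum_const, nsmul_eq_mul]
  congr 2
  exact MonoidHom.card_fiber_eq_of_mem_range π (hπ b) ⟨1, map_one π⟩

/-- A sum over the units of a finite commutative ring of a function vanishing off the units is the
sum over the ring. [folklore] -/
theorem sum_units_eq_sum_of_eq_zero {R : Type*} [CommRing R] [Fintype R] [Fintype Rˣ] [DecidableEq R]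
    (g : R → ℂ) (hg : ∀ x : R, ¬ IsUnit x → g x = 0) : ∑ u : Rˣ, g u = ∑ x : R, g x := by
  have h1 : ∑ u : Rˣ, g u = ∑ x ∈ (Finset.univ : Finset Rˣ).map ⟨Units.val, fun _ _ h => Units.ext h⟩, g x := by
    rw [Finset.sum_map]; rfl
  rw [h1]
  refine Finset.sum_subset (Finset.subset_univ _) fun x _ hx => hg x fun hu => hx ?_
  exact Finset.mem_map.2 ⟨hu.unit, Finset.mem_univ _, rfl⟩

/-- The Gauss sum as a sum over units. [folklore] -/
theorem gaussSum_eq_sum_units {N : ℕ} [NeZero N] (χ : DirichletCharacter ℂ N) (e : AddChar (ZMod N) ℂ) :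
    gaussSum χ e = ∑ u : (ZMod N)ˣ, χ u * e u :=
  (sum_units_eq_sum_of_eq_zero (fun x => χ x * e x) fun x hx => by rw [MulChar.map_nonunit χ hx, zero_mul]).symm

/-- `e^{2πi j/N}` as a value of Mathlib's standard additive character of `ℤ/N`. [folklore] -/
theorem toCircle_natCast_div_eq_stdAddChar {N : ℕ} [NeZero N] (j : ℕ) :
    (AddCircle.toCircle ((((j : ℚ) / N : ℚ) : ℝ) : AddCircle (1 : ℝ)) : ℂ) = ZMod.stdAddChar (N := N) (j : ZMod N) := by
  rw [ZMod.stdAddChar_apply, ZMod.toCircle, AddChar.compAddMonoidHom_apply, ZMod.toAddCircle_natCast]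
  push_cast
  rfl

end Gauss

/-! ### The character sum of the Gauss-sum torus average -/

section CharSum

variable {M : ℕ} [NeZero M] (χ : DirichletCharacter ℂ M)

/-- `(d, m as units of 𝔸_ℚ^∞)`: `natUnitFinite (a b) = natUnitFinite a · natUnitFinite b`. [folklore] -/
theorem Rat.natUnitFinite_mul (a b : ℕ) [NeZero a] [NeZero b] :
    Rat.natUnitFinite (a * b) = Rat.natUnitFinite a * Rat.natUnitFinite b := by
  refine Units.ext ?_
  rw [Units.val_mul, Rat.coe_natUnitFinite, Rat.coe_natUnitFinite, Rat.coe_natUnitFinite, Nat.cast_mul, map_mul]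

/-- `(M⁻¹ as a finite adele) = algebraMap (M⁻¹)`. [folklore] -/
theorem Rat.coe_natUnitFinite_inv (a : ℕ) [NeZero a] :
    (((Rat.natUnitFinite a)⁻¹ : (FiniteAdeleRing (𝓞 ℚ) ℚ)ˣ) : FiniteAdeleRing (𝓞 ℚ) ℚ) =
      algebraMap ℚ (FiniteAdeleRing (𝓞 ℚ) ℚ) ((a : ℚ)⁻¹) := by
  rw [Rat.natUnitFinite, ← map_inv, Units.coe_map, Units.val_inv_eq_inv_val, Units.val_mk0, MonoidHom.coe_coe]

/-- **`ψ_ℚ((0, s M₀⁻¹)) = e^{2πi ā/M₀}` for `s ∈ ẑˣ` with `s ≡ ā (mod N ẑ)`, `M₀ ∣ N`** (`ā` the natural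
lift of `s mod N`). [cite: CasselsFrohlichANT1967, Ch. XV (Tate), §2.2] -/
theorem Rat.adeleAddChar_finiteAdeleInr_unit_mul_inv (N M₀ : ℕ) [NeZero N] [NeZero M₀] (hMN : M₀ ∣ N)
    {s : (FiniteAdeleRing (𝓞 ℚ) ℚ)ˣ} (hs : s ∈ Rat.finiteIntegralUnits) :
    (adeleAddChar ℚ (finiteAdeleInr ℚ ((s : FiniteAdeleRing (𝓞 ℚ) ℚ) *
        (((Rat.natUnitFinite M₀)⁻¹ : (FiniteAdeleRing (𝓞 ℚ) ℚ)ˣ) : FiniteAdeleRing (𝓞 ℚ) ℚ))) : ℂ) =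
      ZMod.stdAddChar (N := M₀) ((((Rat.redMod N (Rat.finUnitHom s) : (ZMod N)ˣ) : ZMod N).val : ℕ) : ZMod M₀) := by
  set n : ℕ := ((Rat.redMod N (Rat.finUnitHom s) : (ZMod N)ˣ) : ZMod N).val with hn
  rw [← toCircle_natCast_div_eq_stdAddChar]
  congr 1
  refine Rat.adeleAddChar_finiteAdeleInr_eq_of_sub_integral _ _ fun w => ?_
  have hsub : (s : FiniteAdeleRing (𝓞 ℚ) ℚ) - algebraMap ℚ (FiniteAdeleRing (𝓞 ℚ) ℚ) (n : ℚ) ∈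
      levelIdeal ℚ (Ideal.span {(M₀ : 𝓞 ℚ)}) :=
    Rat.levelIdeal_le_of_dvd (NeZero.ne N) hMN (Rat.sub_natCast_redMod_mem_levelIdeal hs)
  have e : (s : FiniteAdeleRing (𝓞 ℚ) ℚ) * (((Rat.natUnitFinite M₀)⁻¹ : (FiniteAdeleRing (𝓞 ℚ) ℚ)ˣ) : FiniteAdeleRing (𝓞 ℚ) ℚ) -
      algebraMap ℚ (FiniteAdeleRing (𝓞 ℚ) ℚ) ((n : ℚ) / M₀) =
      (((Rat.natUnitFinite M₀)⁻¹ : (FiniteAdeleRing (𝓞 ℚ) ℚ)ˣ) : FiniteAdeleRing (𝓞 ℚ) ℚ) *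
        ((s : FiniteAdeleRing (𝓞 ℚ) ℚ) - algebraMap ℚ (FiniteAdeleRing (𝓞 ℚ) ℚ) (n : ℚ)) := by
    rw [div_eq_mul_inv, map_mul, ← Rat.coe_natUnitFinite_inv]
    ring
  rw [e]
  exact Rat.natUnitFinite_inv_mul_integral hsub w

/-- **The character sum of the torus average is `#ker · G(χ₀) ≠ 0`.** For `χ` mod `M` with primitive
part `χ₀` mod `M₀`, `N = d M` with `M₀ ∣ d`, and `s : (ℤ/N)ˣ → ẑˣ` a section of the reduction:
`∑_{a ∈ (ℤ/N)ˣ} ψ_ℚ((0, s_a M₀⁻¹)) χ(s_a mod M) = #ker((ℤ/N)ˣ → (ℤ/M₀)ˣ) · G(χ₀) ≠ 0`. [folklore] -/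
theorem gaussTorus_charSum_ne_zero (M₀ m : ℕ) [NeZero M₀] [NeZero m] (hM₀ : M₀ = χ.conductor) :
    ∑ a : (ZMod (M₀ * m * M))ˣ,
      (adeleAddChar ℚ (finiteAdeleInr ℚ ((((rangeSection (Rat.finTorusRed (M₀ * m * M)) a : ↥Rat.finiteIntegralUnits) :
          (FiniteAdeleRing (𝓞 ℚ) ℚ)ˣ) : FiniteAdeleRing (𝓞 ℚ) ℚ) *
        (((Rat.natUnitFinite M₀)⁻¹ : (FiniteAdeleRing (𝓞 ℚ) ℚ)ˣ) : FiniteAdeleRing (𝓞 ℚ) ℚ))) : ℂ) *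
      χ ((Rat.redMod M (Rat.finUnitHom ((rangeSection (Rat.finTorusRed (M₀ * m * M)) a : ↥Rat.finiteIntegralUnits) :
          (FiniteAdeleRing (𝓞 ℚ) ℚ)ˣ)) : (ZMod M)ˣ) : ZMod M) ≠ 0 := by
  subst hM₀
  set M₀ := χ.conductor with hM₀
  set N := M₀ * m * M with hN
  set s : (ZMod N)ˣ → ↥Rat.finiteIntegralUnits := rangeSection (Rat.finTorusRed N) with hs
  have hMN : M ∣ N := Dvd.intro_left _ rfl
  have hM₀M : M₀ ∣ M := χ.conductor_dvd_level
  have hM₀N : M₀ ∣ N := hM₀M.trans hMN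
  set p : (ZMod N)ˣ →* (ZMod M₀)ˣ := ZMod.unitsMap hM₀N with hp
  set χ₀ : DirichletCharacter ℂ M₀ := χ.primitiveCharacter with hχ₀
  -- `r (s a) = a`
  have hsa : ∀ a : (ZMod N)ˣ, Rat.redMod N (Rat.finUnitHom ((s a : ↥Rat.finiteIntegralUnits) : (FiniteAdeleRing (𝓞 ℚ) ℚ)ˣ)) = a :=
    fun a => apply_rangeSection (Rat.finTorusRed N) (Rat.mem_range_finTorusRed N a)
  -- each term is `χ₀ (p a) ψ(p a)`
  have hterm : ∀ a : (ZMod N)ˣ,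
      (adeleAddChar ℚ (finiteAdeleInr ℚ ((((s a : ↥Rat.finiteIntegralUnits) : (FiniteAdeleRing (𝓞 ℚ) ℚ)ˣ) : FiniteAdeleRing (𝓞 ℚ) ℚ) *
        (((Rat.natUnitFinite M₀)⁻¹ : (FiniteAdeleRing (𝓞 ℚ) ℚ)ˣ) : FiniteAdeleRing (𝓞 ℚ) ℚ))) : ℂ) *
      χ ((Rat.redMod M (Rat.finUnitHom ((s a : ↥Rat.finiteIntegralUnits) : (FiniteAdeleRing (𝓞 ℚ) ℚ)ˣ)) : (ZMod M)ˣ) : ZMod M) =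
      χ₀ ((p a : (ZMod M₀)ˣ) : ZMod M₀) * ZMod.stdAddChar (N := M₀) ((p a : (ZMod M₀)ˣ) : ZMod M₀) := by
    intro a
    rw [Rat.adeleAddChar_finiteAdeleInr_unit_mul_inv N M₀ hM₀N (s a).2, hsa, ZMod.natCast_val, mul_comm]
    congr 1
    · rw [← Rat.unitsMap_redMod hMN (s a).2, hsa]
      have hpa : p a = ZMod.unitsMap hM₀M (ZMod.unitsMap hMN a) := by
        rw [← MonoidHom.comp_apply, ZMod.unitsMap_comp]
      rw [hpa]
      conv_lhs => rw [← DirichletCharacter.changeLevel_primitiveCharacter χ]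
      rw [← MulChar.coe_toUnitHom, DirichletCharacter.changeLevel_toUnitHom, MonoidHom.comp_apply, MulChar.coe_toUnitHom]
  rw [Finset.sum_congr rfl fun a _ => hterm a,
    sum_comp_eq_card_fiber_smul p (ZMod.unitsMap_surjective hM₀N) fun b : (ZMod M₀)ˣ => χ₀ (b : ZMod M₀) * ZMod.stdAddChar (N := M₀) (b : ZMod M₀),
    ← gaussSum_eq_sum_units]
  refine mul_ne_zero ?_ (DirichletCharacter.IsPrimitive.gaussSum_stdAddChar_ne_zero (DirichletCharacter.primitiveCharacter_isPrimitive χ))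
  rw [Nat.cast_ne_zero, ← pos_iff_ne_zero, Finset.card_pos]
  exact ⟨1, Finset.mem_filter.2 ⟨Finset.mem_univ _, map_one p⟩⟩

end CharSum

/-! ### Whittaker coefficients of the torus average; vanishing of `W_v` along the torus -/

section Analysis

variable [MeasurableSpace ↥(adelicUnipotent 2 ℚ)] [BorelSpace ↥(adelicUnipotent 2 ℚ)]
  {ν : Measure ↥(adelicUnipotent 2 ℚ)} [IsFiniteMeasureOnCompacts ν] [ν.IsMulRightInvariant]
  [MeasurableMul ↥(adelicUnipotent 2 ℚ)] [Countable ↥(rationalUnipotent 2 ℚ)]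
  [MeasurableConstSMul ↥(rationalUnipotent 2 ℚ) ↥(adelicUnipotent 2 ℚ)]
  [SMulInvariantMeasure ↥(rationalUnipotent 2 ℚ) ↥(adelicUnipotent 2 ℚ) ν]
  {𝓕 : Set ↥(adelicUnipotent 2 ℚ)} (h𝓕 : IsFundamentalDomain ↥(rationalUnipotent 2 ℚ) 𝓕 ν)
  (h𝓕c : IsCompact (closure 𝓕))
  {M : ℕ} [NeZero M] (χ : DirichletCharacter ℂ M) {v : (AdelicGroupData.gl 2 ℚ).Adelic → ℂ}
  (hv : ∀ k ∈ gammaOneFiniteLevel ℚ (Ideal.span {((M ^ 2 : ℕ) : 𝓞 ℚ)}),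
    rightTranslation (AdelicGroupData.gl 2 ℚ) (GLn.ofFinite 2 ℚ k) v =
      χ ((Rat.rayClassHom M (Matrix.GeneralLinearGroup.det (GLn.ofFinite 2 ℚ k)) : (ZMod M)ˣ) : ZMod M) • v)
  (hl : IsLeftInvariant (AdelicGroupData.gl 2 ℚ) v) (hvc : Continuous v)

omit [BorelSpace ↥(adelicUnipotent 2 ℚ)] [IsFiniteMeasureOnCompacts ν] [ν.IsMulRightInvariant]
  [MeasurableMul ↥(adelicUnipotent 2 ℚ)] [Countable ↥(rationalUnipotent 2 ℚ)]
  [MeasurableConstSMul ↥(rationalUnipotent 2 ℚ) ↥(adelicUnipotent 2 ℚ)]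
  [SMulInvariantMeasure ↥(rationalUnipotent 2 ℚ) ↥(adelicUnipotent 2 ℚ) ν] in
include hv in
/-- `W_v((h, d(y) d(s))) = χ(s mod M) W_v((h, d(y)))` for `s ∈ ẑˣ`. [folklore] -/
theorem whittakerCoeff_torus_mul_unit (h : GL (Fin 2) ℝ) (y : (FiniteAdeleRing (𝓞 ℚ) ℚ)ˣ) {s : (FiniteAdeleRing (𝓞 ℚ) ℚ)ˣ}
    (hs : s ∈ Rat.finiteIntegralUnits) :
    whittakerCoeff ν 𝓕 (adeleAddChar ℚ) v (Rat.ofRealGL 2 h * GLn.ofFinite 2 ℚ (diagGL2 (y * s) 1)) =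
      χ ((Rat.redMod M (Rat.finUnitHom s) : (ZMod M)ˣ) : ZMod M) *
        whittakerCoeff ν 𝓕 (adeleAddChar ℚ) v (Rat.ofRealGL 2 h * GLn.ofFinite 2 ℚ (diagGL2 y 1)) := by
  have e : diagGL2 (y * s) 1 = diagGL2 y 1 * diagGL2 s (1 : (FiniteAdeleRing (𝓞 ℚ) ℚ)ˣ) := by
    rw [← diagGL2_mul, mul_one]
  rw [e, map_mul, ← mul_assoc, whittakerCoeff_mul_ofFinite_eq_rightTranslation, rightTranslation_diagGL2_eq χ hv hs]
  exact whittakerCoeff_const_smul ν 𝓕 (adeleAddChar ℚ) _ v _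

omit [BorelSpace ↥(adelicUnipotent 2 ℚ)] [IsFiniteMeasureOnCompacts ν] in
include h𝓕 hl hv in
/-- **The Whittaker coefficient of a summand of `B_d v`**:
`W_v((h, d(y)) (1, d(s) n(d⁻¹))) = ψ_ℚ((0, y s d⁻¹)) χ(s mod M) W_v((h, d(y)))`. [folklore] -/
theorem whittakerCoeff_torus_summand (d : ℕ) [NeZero d] (h : GL (Fin 2) ℝ) (y : (FiniteAdeleRing (𝓞 ℚ) ℚ)ˣ)
    {s : (FiniteAdeleRing (𝓞 ℚ) ℚ)ˣ} (hs : s ∈ Rat.finiteIntegralUnits) :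
    whittakerCoeff ν 𝓕 (adeleAddChar ℚ) v (Rat.ofRealGL 2 h * GLn.ofFinite 2 ℚ (diagGL2 y 1) *
        (GLn.ofFinite 2 ℚ (diagGL2 s 1) * Rat.invUnipotent d)) =
      adeleAddChar ℚ (finiteAdeleInr ℚ (((y * s * (Rat.natUnitFinite d)⁻¹ : (FiniteAdeleRing (𝓞 ℚ) ℚ)ˣ) : FiniteAdeleRing (𝓞 ℚ) ℚ))) *
        (χ ((Rat.redMod M (Rat.finUnitHom s) : (ZMod M)ˣ) : ZMod M) *
          whittakerCoeff ν 𝓕 (adeleAddChar ℚ) v (Rat.ofRealGL 2 h * GLn.ofFinite 2 ℚ (diagGL2 y 1))) := by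
  have e : Rat.ofRealGL 2 h * GLn.ofFinite 2 ℚ (diagGL2 y 1) * (GLn.ofFinite 2 ℚ (diagGL2 s 1) * Rat.invUnipotent d) =
      Rat.ofRealGL 2 h * GLn.ofFinite 2 ℚ (diagGL2 (y * s) 1 *
        ((unipotentGL2 (((Rat.natUnitFinite d)⁻¹ : (FiniteAdeleRing (𝓞 ℚ) ℚ)ˣ) : FiniteAdeleRing (𝓞 ℚ) ℚ) :
          ↥(upperUnitriangular (Fin 2) (FiniteAdeleRing (𝓞 ℚ) ℚ))) : GL (Fin 2) (FiniteAdeleRing (𝓞 ℚ) ℚ))) := by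
    rw [Rat.invUnipotent, mul_assoc, ← map_mul, ← map_mul, ← mul_assoc (diagGL2 y 1), ← diagGL2_mul, mul_one]
  rw [e, whittakerCoeff_ofRealGL_mul_ofFinite_diagGL2_mul_unipotentGL2 h𝓕 (isGlobalAddChar_adeleAddChar (K := ℚ)) hl,
    whittakerCoeff_torus_mul_unit χ hv h y hs]
  simp only [Units.val_mul]

include h𝓕 h𝓕c hl hv hvc in
/-- **If `B_{M₀ m} v = 0` then `W_v((h, d(m))) = 0` for all `h ∈ GL₂(ℝ)`**: the Whittaker coefficient of
`B_d v` at `(h, d(m))`, `d = M₀ m`, is `(∑_a ψ_ℚ((0, s_a M₀⁻¹)) χ(s_a mod M)) · W_v((h, d(m)))`, and the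
character sum is `#ker · G(χ₀) ≠ 0` (`gaussTorus_charSum_ne_zero`). [folklore] -/
theorem whittakerCoeff_torus_natCast_eq_zero (m d : ℕ) [NeZero m] [NeZero d] (hd : d = χ.conductor * m)
    (hB : gaussTorusAverage M d v = 0) (h : GL (Fin 2) ℝ) :
    whittakerCoeff ν 𝓕 (adeleAddChar ℚ) v (Rat.ofRealGL 2 h * GLn.ofFinite 2 ℚ (diagGL2 (Rat.natUnitFinite m) 1)) = 0 := by
  subst hd
  haveI : NeZero χ.conductor := ⟨χ.conductor_ne_zero⟩
  set M₀ := χ.conductor with hM₀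
  set N := M₀ * m * M with hN
  set s : (ZMod N)ˣ → ↥Rat.finiteIntegralUnits := rangeSection (Rat.finTorusRed N) with hs
  set yv : (ZMod N)ˣ → GL (Fin 2) (AdeleRing (𝓞 ℚ) ℚ) := fun a =>
    GLn.ofFinite 2 ℚ (diagGL2 ((s a : ↥Rat.finiteIntegralUnits) : (FiniteAdeleRing (𝓞 ℚ) ℚ)ˣ) 1) * Rat.invUnipotent (M₀ * m) with hyv
  set g : GL (Fin 2) (AdeleRing (𝓞 ℚ) ℚ) := Rat.ofRealGL 2 h * GLn.ofFinite 2 ℚ (diagGL2 (Rat.natUnitFinite m) 1) with hg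
  -- the pointwise identity `∑_a v(x y_a) = B_d v (x) = 0`
  have hpt : ∀ x : GL (Fin 2) (AdeleRing (𝓞 ℚ) ℚ), ∑ a : (ZMod N)ˣ, v (x * yv a) = 0 * v x := fun x => by
    rw [zero_mul, ← gaussTorusAverage_apply (M := M) (d := M₀ * m) v x, hB]
    rfl
  -- hence `∑_a W_v(g y_a) = 0`
  have hW := sum_whittakerCoeff_mul_eq (ν := ν) (𝓕 := 𝓕) (ψ := adeleAddChar ℚ) Finset.univ yv hpt g
    fun a _ => integrableOn_whittakerIntegrand_of_continuous h𝓕c (continuous_adeleAddChar ℚ) hvc _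
  rw [zero_mul] at hW
  -- each term: `ψ((0, s_a M₀⁻¹)) χ(s_a mod M) W_v(g)`
  have hterm : ∀ a : (ZMod N)ˣ, whittakerCoeff ν 𝓕 (adeleAddChar ℚ) v (g * yv a) =
      (adeleAddChar ℚ (finiteAdeleInr ℚ ((((s a : ↥Rat.finiteIntegralUnits) : (FiniteAdeleRing (𝓞 ℚ) ℚ)ˣ) : FiniteAdeleRing (𝓞 ℚ) ℚ) *
        (((Rat.natUnitFinite M₀)⁻¹ : (FiniteAdeleRing (𝓞 ℚ) ℚ)ˣ) : FiniteAdeleRing (𝓞 ℚ) ℚ))) : ℂ) *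
      χ ((Rat.redMod M (Rat.finUnitHom ((s a : ↥Rat.finiteIntegralUnits) : (FiniteAdeleRing (𝓞 ℚ) ℚ)ˣ)) : (ZMod M)ˣ) : ZMod M) *
        whittakerCoeff ν 𝓕 (adeleAddChar ℚ) v g := by
    intro a
    -- `m · s · (M₀ m)⁻¹ = s · M₀⁻¹` in `(𝔸_ℚ^∞)ˣ`
    have eu : Rat.natUnitFinite m * ((s a : ↥Rat.finiteIntegralUnits) : (FiniteAdeleRing (𝓞 ℚ) ℚ)ˣ) * (Rat.natUnitFinite (M₀ * m))⁻¹ =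
        ((s a : ↥Rat.finiteIntegralUnits) : (FiniteAdeleRing (𝓞 ℚ) ℚ)ˣ) * (Rat.natUnitFinite M₀)⁻¹ := by
      rw [Rat.natUnitFinite_mul, _root_.mul_inv_rev, ← mul_assoc, mul_comm (Rat.natUnitFinite m),
        mul_inv_cancel_right]
    rw [hg, hyv, whittakerCoeff_torus_summand h𝓕 χ hv hl (M₀ * m) h (Rat.natUnitFinite m) (s a).2, ← mul_assoc, eu,
      Units.val_mul]
  rw [Finset.sum_congr rfl fun a _ => hterm a, ← Finset.sum_mul] at hW
  exact (mul_eq_zero.1 hW).resolve_left (gaussTorus_charSum_ne_zero χ M₀ m hM₀)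

include h𝓕 h𝓕c hl hv hvc in
/-- **`W_v((h, d(y))) = 0` for every finite idele `y`**, if all `B_{M₀ m} v` vanish: an integral `y` is
`m · w` with `w ∈ ẑˣ` (`Rat.exists_natCast_mul_of_integral`), and `W_v` vanishes at `d(y)` for
non-integral `y` because `v` is `n(ẑ)`-fixed (`whittakerCoeff_ofRealGL_mul_ofFinite_diagGL2_eq_zero`).
[folklore] -/
theorem whittakerCoeff_torus_eq_zero
    (hB : ∀ (m d : ℕ) [NeZero m] [NeZero d], d = χ.conductor * m → gaussTorusAverage M d v = 0)
    (h : GL (Fin 2) ℝ) (y : (FiniteAdeleRing (𝓞 ℚ) ℚ)ˣ) :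
    whittakerCoeff ν 𝓕 (adeleAddChar ℚ) v (Rat.ofRealGL 2 h * GLn.ofFinite 2 ℚ (diagGL2 y 1)) = 0 := by
  by_cases hint : ∀ w : HeightOneSpectrum (𝓞 ℚ), Valued.v ((y : FiniteAdeleRing (𝓞 ℚ) ℚ) w) ≤ 1
  · obtain ⟨m, w, hm, hw, hyw⟩ := Rat.exists_natCast_mul_of_integral y hint
    haveI : NeZero m := ⟨hm⟩
    have e : y = Rat.natUnitFinite m * w := Units.ext (by rw [hyw, Units.val_mul, Rat.coe_natUnitFinite])
    haveI : NeZero (χ.conductor * m) := ⟨mul_ne_zero χ.conductor_ne_zero hm⟩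
    rw [e, whittakerCoeff_torus_mul_unit χ hv h _ hw,
      whittakerCoeff_torus_natCast_eq_zero h𝓕 h𝓕c χ hv hl hvc m (χ.conductor * m) rfl (hB m _ rfl) h, mul_zero]
  · push Not at hint
    obtain ⟨w, hw⟩ := hint
    have hy : (y : FiniteAdeleRing (𝓞 ℚ) ℚ) w ∉ w.adicCompletionIntegers ℚ := by
      rw [HeightOneSpectrum.mem_adicCompletionIntegers, not_le]; exact hw
    obtain ⟨z, hz, hne⟩ := Rat.exists_integral_adeleAddChar_finiteAdeleInr_mul_ne_one hy
    refine whittakerCoeff_ofRealGL_mul_ofFinite_diagGL2_eq_zero h𝓕 (isGlobalAddChar_adeleAddChar (K := ℚ)) hl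
      (fun z' hz' x => ?_) h hz hne
    exact congrFun (rightTranslation_unipotentGL2_eq χ hv hz') x

omit [IsFiniteMeasureOnCompacts ν] [ν.IsMulRightInvariant] [MeasurableMul ↥(adelicUnipotent 2 ℚ)]
  [Countable ↥(rationalUnipotent 2 ℚ)] [MeasurableConstSMul ↥(rationalUnipotent 2 ℚ) ↥(adelicUnipotent 2 ℚ)]
  [SMulInvariantMeasure ↥(rationalUnipotent 2 ℚ) ↥(adelicUnipotent 2 ℚ) ν] in
include h𝓕 in
/-- **From the torus to `GL₂(ℝ)`: `v((h, 1)) = 0`** if `W_v((h', d(y))) = 0` for all `h'`, `y` — the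
Fourier–Whittaker expansion `v(g) = ∑_{ξ ∈ ℚˣ} W_v(diag(ξ, 1) g)` of the cusp form `v`
(`Shalika1974_fourierExpansion_cuspForm_two`) at `g = (h, 1)`, where `diag(ξ, 1) (h, 1) = ((ξ,1)h, d(ξ))`.
[cite: CogdellAnalyticTheory2004, Thm. 1.1] -/
theorem apply_ofRealGL_eq_zero_of_whittakerCoeff_torus [ν.IsHaarMeasure] (h𝓕m : MeasurableSet 𝓕)
    {hcpt : isCompact_glFiniteIntegralLevel 2 ℚ} (hcf : IsCuspFormGL 2 ℚ hcpt v)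
    (hW : ∀ (h : GL (Fin 2) ℝ) (y : (FiniteAdeleRing (𝓞 ℚ) ℚ)ˣ),
      whittakerCoeff ν 𝓕 (adeleAddChar ℚ) v (Rat.ofRealGL 2 h * GLn.ofFinite 2 ℚ (diagGL2 y 1)) = 0)
    (h : GL (Fin 2) ℝ) : v (Rat.ofRealGL 2 h) = 0 := by
  obtain ⟨-, hsum⟩ := Shalika1974_fourierExpansion_cuspForm_two (K := ℚ) ν h𝓕m h𝓕
    (isGlobalAddChar_adeleAddChar (K := ℚ)) hcf (Rat.ofRealGL 2 h)
  have hsum' : HasSum (fun δ : GL (Fin 1) ℚ ⧸ upperUnitriangular (Fin 1) ℚ =>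
      whittakerCoeff ν 𝓕 (adeleAddChar ℚ) v (glCorner (AdeleRing (𝓞 ℚ) ℚ) (show 1 ≤ 2 by norm_num)
        (Matrix.GeneralLinearGroup.map (algebraMap ℚ (AdeleRing (𝓞 ℚ) ℚ)) δ.out⁻¹) * Rat.ofRealGL 2 h)) (v (Rat.ofRealGL 2 h)) :=
    hsum
  have hzero : ∀ δ : GL (Fin 1) ℚ ⧸ upperUnitriangular (Fin 1) ℚ,
      whittakerCoeff ν 𝓕 (adeleAddChar ℚ) v (glCorner (AdeleRing (𝓞 ℚ) ℚ) (show 1 ≤ 2 by norm_num)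
        (Matrix.GeneralLinearGroup.map (algebraMap ℚ (AdeleRing (𝓞 ℚ) ℚ)) δ.out⁻¹) * Rat.ofRealGL 2 h) = 0 := by
    intro δ
    set ξ : ℚˣ := Matrix.GeneralLinearGroup.det (δ.out⁻¹ : GL (Fin 1) ℚ) with hξ
    have e1 : glCorner (AdeleRing (𝓞 ℚ) ℚ) (show 1 ≤ 2 by norm_num)
        (Matrix.GeneralLinearGroup.map (algebraMap ℚ (AdeleRing (𝓞 ℚ) ℚ)) δ.out⁻¹) = ratDiagGL2 ℚ ξ :=
      glCorner_map_eq_ratDiagGL2 (K := ℚ) _ _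
    set x : GL (Fin 2) (AdeleRing (𝓞 ℚ) ℚ) := ratDiagGL2 ℚ ξ * Rat.ofRealGL 2 h with hx
    have hsnd : GLn.sndHom 2 ℚ x = diagGL2 (Units.map (algebraMap ℚ (FiniteAdeleRing (𝓞 ℚ) ℚ) : ℚ →* FiniteAdeleRing (𝓞 ℚ) ℚ) ξ) 1 := by
      rw [hx, map_mul, Rat.sndHom_ofRealGL, mul_one, ← map_diagGL2_eq_ratDiagGL2]
      change GLn.sndHom 2 ℚ (GLn.ofGlobal 2 ℚ (diagGL2 ξ 1)) = _
      rw [Rat.sndHom_ofGlobal, map_diagGL2, map_one]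
    have e2 : x = Rat.ofRealGL 2 (Rat.archGL 2 x) * GLn.ofFinite 2 ℚ (diagGL2 (Units.map (algebraMap ℚ (FiniteAdeleRing (𝓞 ℚ) ℚ) :
        ℚ →* FiniteAdeleRing (𝓞 ℚ) ℚ) ξ) 1) := by
      rw [← hsnd, Rat.ofRealGL_archGL_mul_ofFinite_sndHom]
    rw [e1, ← hx, e2]
    exact hW _ _
  have hz : (fun δ : GL (Fin 1) ℚ ⧸ upperUnitriangular (Fin 1) ℚ =>
      whittakerCoeff ν 𝓕 (adeleAddChar ℚ) v (glCorner (AdeleRing (𝓞 ℚ) ℚ) (show 1 ≤ 2 by norm_num)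
        (Matrix.GeneralLinearGroup.map (algebraMap ℚ (AdeleRing (𝓞 ℚ) ℚ)) δ.out⁻¹) * Rat.ofRealGL 2 h)) = fun _ => 0 :=
    funext hzero
  rw [hz] at hsum'
  exact hsum'.unique hasSum_zero

omit [MeasurableSpace ↥(adelicUnipotent 2 ℚ)] [BorelSpace ↥(adelicUnipotent 2 ℚ)] [MeasurableMul ↥(adelicUnipotent 2 ℚ)]
  [Countable ↥(rationalUnipotent 2 ℚ)] [MeasurableConstSMul ↥(rationalUnipotent 2 ℚ) ↥(adelicUnipotent 2 ℚ)] in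
include hv hl in
/-- **From `GL₂(ℝ)` to `GL₂(𝔸_ℚ)`: `v = 0`** if `v((h, 1)) = 0` for all `h` — strong approximation
`GL₂(𝔸_ℚ) = GL₂(ℚ) (GL₂(ℝ)⁺ × K₁(M²))` (`Rat.exists_ofGlobal_inv_mul_mem_plusLevelOne`) and the
eigenvector property `v((h, k)) = χ([det k]) v((h, 1))`. [cite: Gelbart1975, (3.4)] -/
theorem eq_zero_of_apply_ofRealGL_eq_zero (h0 : ∀ h : GL (Fin 2) ℝ, v (Rat.ofRealGL 2 h) = 0) : v = 0 := by
  funext x'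
  set x : GL (Fin 2) (AdeleRing (𝓞 ℚ) ℚ) := x' with hx'
  obtain ⟨γ, hγ⟩ := Rat.exists_ofGlobal_inv_mul_mem_plusLevelOne (Ideal.span {((M ^ 2 : ℕ) : 𝓞 ℚ)}) x
  rw [Rat.mem_plusLevelOne_iff] at hγ
  set y : GL (Fin 2) (AdeleRing (𝓞 ℚ) ℚ) := (GLn.ofGlobal 2 ℚ γ)⁻¹ * x with hy
  have hx : x = GLn.ofGlobal 2 ℚ γ * y := by rw [hy, mul_inv_cancel_left]
  have hy' : y = Rat.ofRealGL 2 (Rat.archGL 2 y) * GLn.ofFinite 2 ℚ (GLn.sndHom 2 ℚ y) :=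
    (Rat.ofRealGL_archGL_mul_ofFinite_sndHom 2 y).symm
  have h1 : v x = v y := by rw [hx]; exact hl _ ⟨γ, rfl⟩ _
  have h2 : v y = (rightTranslation (AdelicGroupData.gl 2 ℚ) (GLn.ofFinite 2 ℚ (GLn.sndHom 2 ℚ y)) v) (Rat.ofRealGL 2 (Rat.archGL 2 y)) := by
    rw [rightTranslation_apply]
    exact congrArg v hy'
  change v x = 0
  rw [h1, h2, hv _ hγ.2, Pi.smul_apply, h0, smul_zero]

end Analysis

/-! ### The main theorem -/

section Main

variable {hcpt : isCompact_glFiniteIntegralLevel 2 ℚ}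

/-- **Existence of the new vector (Casselman 1973, Thm. 1, existence half; global form).** Let `π` be
an automorphic representation of `GL₂(𝔸_ℚ)` (Borel–Jacquet datum) whose forms are cusp forms, and
`ψ ∈ π` a non-zero `K(M)`-fixed form. Then `π` contains a non-zero form right invariant under
`{1} × K₁(L)` for some `L ≥ 1` (namely a Gauss-sum torus average `B_{M₀ m} v` of the
`χ ∘ [det]`-eigenvector `v` of `K₁(M²)` attached to `ψ`, `L = (M₀ m M)²`). Casselman proves the local
statement `π_p^{K₁(p^{c(π_p)})} ≠ 0` from the Kirillov model; the proof here is global (Whittaker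
coefficients of `B_d v`, `G(χ₀) ≠ 0`, the Fourier–Whittaker expansion of cusp forms and strong
approximation), see the module docstring. [cite: Casselman1973, Thm. 1] [cite: Gelbart1975, Thm. 5.19] -/
theorem AutomorphicRepData.exists_mem_gammaOneFiniteInvariants_of_fixed
    (π : AutomorphicRepData (AutomorphyDatum.gl 2 ℚ hcpt)) (hcusp : π.W ≤ cuspFormsGL 2 ℚ hcpt)
    {M : ℕ} [NeZero M] {ψ : (AdelicGroupData.gl 2 ℚ).Adelic → ℂ} (hψW : ψ ∈ π.W) (hψ0 : ψ ≠ 0)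
    (hfix : ∀ u ∈ principalCongruenceLevel 2 ℚ (Ideal.span {(M : 𝓞 ℚ)}), rightTranslation (AdelicGroupData.gl 2 ℚ) u ψ = ψ) :
    ∃ (L : ℕ) (_ : NeZero L), ∃ θ ∈ π.W, θ ≠ 0 ∧ θ ∈ gammaOneFiniteInvariants L := by
  obtain ⟨χ, v, hvW, hv0, hv⟩ := π.exists_detChar_eigenvector hψW hψ0 hfix
  by_cases hex : ∃ (d : ℕ) (_ : NeZero d), gaussTorusAverage M d v ≠ 0
  · obtain ⟨d, hd, hB⟩ := hex
    exact ⟨(d * M) ^ 2, inferInstance, _, gaussTorusAverage_mem π hvW, hB,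
      gaussTorusAverage_mem_gammaOneFiniteInvariants χ hv⟩
  · exfalso
    apply hv0
    -- the Whittaker datum on `N₂(𝔸_ℚ)`
    letI : MeasurableSpace ↥(adelicUnipotent 2 ℚ) := borel _
    haveI : BorelSpace ↥(adelicUnipotent 2 ℚ) := ⟨rfl⟩
    obtain ⟨ν, hν, hνR, hνS, h𝓕, h𝓕m, h𝓕c, -, -⟩ := exists_isHaarMeasure_isFundamentalDomain_adelicUnipotent 2 ℚ
    haveI := hν
    haveI := hνR
    haveI := hνS
    -- `v` is a continuous cusp form, left `GL₂(ℚ)`-invariant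
    have hcf : IsCuspFormGL 2 ℚ hcpt v := isCuspFormGL_of_mem_cuspFormsGL' (hcusp hvW)
    have hl : IsLeftInvariant (AdelicGroupData.gl 2 ℚ) v := hcf.1.leftInvariant
    have hvc : Continuous v := hcf.1.continuous_gl
    have hB : ∀ (m d : ℕ) [NeZero m] [NeZero d], d = χ.conductor * m → gaussTorusAverage M d v = 0 :=
      fun m d _ hd _ => by
        by_contra h; exact hex ⟨d, hd, h⟩
    refine eq_zero_of_apply_ofRealGL_eq_zero χ hv hl fun h => ?_
    exact apply_ofRealGL_eq_zero_of_whittakerCoeff_torus h𝓕 h𝓕m hcf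
      (fun h' y => whittakerCoeff_torus_eq_zero h𝓕 h𝓕c χ hv hl hvc hB h' y) h

/-- **Every automorphic representation of `GL₂(𝔸_ℚ)` with cuspidal forms has a new vector**: a
non-zero form right invariant under `{1} × K₁(L)` for some `L ≥ 1` (a level `K(𝔫)` of a form of
`π`, `exists_principalCongruenceLevel_fixed`, contains `K(M)` for `M = N(𝔫)`).
[cite: Casselman1973, Thm. 1] [cite: Gelbart1975, Thm. 5.19] -/
theorem AutomorphicRepData.exists_mem_gammaOneFiniteInvariants (π : AutomorphicRepData (AutomorphyDatum.gl 2 ℚ hcpt))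
    (hcusp : π.W ≤ cuspFormsGL 2 ℚ hcpt) :
    ∃ (L : ℕ) (_ : NeZero L), ∃ θ ∈ π.W, θ ≠ 0 ∧ θ ∈ gammaOneFiniteInvariants L := by
  obtain ⟨𝔫, h𝔫, φ, hφW, hφW', hfix⟩ := π.exists_principalCongruenceLevel_fixed
  set M := Ideal.absNorm 𝔫 with hM
  have hM0 : M ≠ 0 := fun h => h𝔫 (Ideal.absNorm_eq_zero_iff.1 h)
  haveI : NeZero M := ⟨hM0⟩
  have hle : Ideal.span {(M : 𝓞 ℚ)} ≤ 𝔫 := by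
    rw [Ideal.span_singleton_le_iff_mem]; exact Ideal.absNorm_mem 𝔫
  have hfix' : ∀ u ∈ principalCongruenceLevel 2 ℚ (Ideal.span {(M : 𝓞 ℚ)}), rightTranslation (AdelicGroupData.gl 2 ℚ) u φ = φ :=
    fun u hu => hfix u (principalCongruenceLevel_mono 2 ℚ (Rat.span_natCast_ne_zero M) hle hu)
  have hφ0 : φ ≠ 0 := fun h => hφW' (h ▸ π.W'.zero_mem)
  exact π.exists_mem_gammaOneFiniteInvariants_of_fixed hcusp hφW hφ0 hfix'

/-- **The new vector of a cuspidal automorphic representation of `GL₂(𝔸_ℚ)`** in the form of the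
hypothesis `hfix` of `StrongArtinGL2WeightOneAssembly.exists_isNewform1_of_isPiOfArtinRep_of_pair_of_fixed`:
some `N ≥ 1` and a non-zero `φ ∈ π` with `r((1, u)) φ = φ` for all `u ∈ K₁(N)`.
[cite: Casselman1973, Thm. 1] [cite: Gelbart1975, Thm. 5.19] -/
theorem CuspidalAutomorphicRepData.exists_gammaOneFiniteLevel_fixed (π : CuspidalAutomorphicRepData 2 ℚ hcpt) :
    ∃ (N : ℕ) (_ : NeZero N), ∃ φ ∈ π.1.W, φ ≠ 0 ∧
      ∀ u ∈ gammaOneFiniteLevel ℚ (Ideal.span {(N : 𝓞 ℚ)}),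
        rightTranslation (AdelicGroupData.gl 2 ℚ) (GLn.ofFinite 2 ℚ u) φ = φ := by
  obtain ⟨L, hL, θ, hθW, hθ0, hθ⟩ := π.1.exists_mem_gammaOneFiniteInvariants π.2
  exact ⟨L, hL, θ, hθW, hθ0, (mem_gammaOneFiniteInvariants_iff_rightTranslation.1 hθ)⟩

end Main

end Literature.NumberTheory.Automorphic

end
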